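import Summits.CriticalPhenomena.Ising3DConformalLimit.Theorems.PerfectScreeningCoulombImpliesNontrivialSusceptibilityOfIsotherm
import Literature.Probability.LatticeModels.TwoPointSupNormMonotone
import HarnessLib

/-!
# Finite-box fluctuation–response at `β_c(3)` in a field

Support file for crux `EtaPositive` (stmt-CriticalPhenomena-2600) of route `AnomalousForcesInteraction`
(sub-problem `Ising3DConformalLimit`), line `birth` ("`η(3) > 0` from the critical isotherm"): it proves
the stub `stub_boxResponse`, the first hypothesis of the sorry-free composition
`etaPositive_of_boxResponse_isothermGain`.

For the nearest-neighbour Ising model on `ℤ³` at `β = β_c(3)`, a field `h > 0`, a radius `R : ℕ` and a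
site `x` with `3R ≤ ‖x‖_∞`,

  `(2R+1)³ · (⟨σ₀σ_x⟩⁺_{β_c,0} - m(β_c,h)²) ≤ m(β_c,h) / (β_c h)`,   `m(β,h) = ⟨σ₀⟩⁺_{β,h}`.

Proof (four proved tree theorems chained):

1. weak GHS susceptibility bound in a field (`sum_plusTrunc_le_mag_div`):
   `Σ_{y ∈ Λ_R} (⟨σ₀σ_y⟩⁺_{β,h} - m²) ≤ m/(βh)`;
2. GKS monotonicity in the field (`plusCorr_mono_params`): `⟨σ₀σ_y⟩⁺_{β,0} ≤ ⟨σ₀σ_y⟩⁺_{β,h}`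
   (`twoPointPlus_le_plusExpect_spinPair` below; at `y = 0` both sides equal `1`);
3. Messager–Miracle-Solé averaging in the sup norm (`card_box_mul_twoPointPlus_le_sum_box`):
   `|Λ_R| ⟨σ₀σ_x⟩⁺_{β,0} ≤ Σ_{y ∈ Λ_R} ⟨σ₀σ_y⟩⁺_{β,0}` for `3R ≤ ‖x‖_∞`;
4. `|Λ_R| = (2R+1)³` (`card_box`).

References: Griffiths–Hurst–Sherman 1970 (GHS); Griffiths 1967 / Kelly–Sherman 1968 (GKS);
Messager–Miracle-Solé 1977, in the form of Aizenman–Duminil-Copin, Ann. of Math. 194 (2021), eq. (5.3);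
Friedli–Velenik, *Statistical Mechanics of Lattice Systems* (2017), Ch. 3. All inputs are proved theorems
of the tree.
-/

noncomputable section

namespace Summit.CriticalPhenomena.Ising3DConformalLimit.AnomalousForcesInteractionEtaPositive

open Literature.Probability.LatticeModels Finset

/-- **GKS monotonicity in the field for the pair observable**: for `β, h ≥ 0` and every site `y`,
`⟨σ₀σ_y⟩⁺_{β,0} ≤ ⟨σ₀σ_y⟩⁺_{β,h}`. For `y ≠ 0` both sides are plus-state correlations of `σ_{{0,y}}`
and the claim is `plusCorr_mono_params`; for `y = 0` both sides equal `1` (`σ₀² = 1`). -/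
theorem twoPointPlus_le_plusExpect_spinPair {d : ℕ} {β h : ℝ} (hβ : 0 ≤ β) (hh : 0 ≤ h)
    (y : Site d) : twoPointPlus d β y ≤ plusExpect d β h (spinPair 0 y) := by
  by_cases hy : y = 0
  · subst hy
    have h1 : plusExpect d β h (spinPair (0 : Site d) 0) = plusCorr d β h ∅ := by
      rw [plusCorr, spinPair_self]
      exact congrArg _ (funext fun s => (spinProduct_empty s).symm)
    rw [twoPointPlus_zero, h1, plusCorr_empty hβ hh]
  · rw [twoPointPlus_eq_plusCorr β hy, spinPair_eq_spinProduct (Ne.symm hy)]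
    change plusCorr d β 0 {0, y} ≤ plusCorr d β h {0, y}
    exact plusCorr_mono_params hβ le_rfl le_rfl hh {0, y}

/-- **Finite-box fluctuation–response at `β_c(3)` in a field** (stub `stub_boxResponse` of line `birth`,
crux `EtaPositive`): for `h > 0`, `R : ℕ` and `3R ≤ ‖x‖_∞`,
`(2R+1)³ (⟨σ₀σ_x⟩⁺_{β_c(3),0} - m(β_c(3),h)²) ≤ m(β_c(3),h)/(β_c(3) h)`.
GHS chord bound (`sum_plusTrunc_le_mag_div`) + GKS monotonicity in `h`
(`twoPointPlus_le_plusExpect_spinPair`) + Messager–Miracle-Solé averaging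
(`card_box_mul_twoPointPlus_le_sum_box`) + `|Λ_R| = (2R+1)³` (`card_box`). -/
theorem stub_boxResponse :
    ∀ h : ℝ, 0 < h → ∀ (R : ℕ) (x : Site 3), 3 * (R : ℝ) ≤ ‖x‖ →
      (2 * (R : ℝ) + 1) ^ 3 *
          (criticalTwoPoint 3 x - magnetizationInField 3 (criticalBeta 3) h ^ 2) ≤
        magnetizationInField 3 (criticalBeta 3) h / (criticalBeta 3 * h) := by
  intro h hh R x hx
  have hβ : 0 < criticalBeta 3 := criticalBeta_pos_holds (d := 3) (by norm_num)
  -- (3) Messager–Miracle-Solé averaging over the box `Λ_R`, `3R ≤ ‖x‖_∞`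
  have hxR : 3 * R ≤ Site.supNorm x := by
    rw [Site.norm_eq_supNorm] at hx
    exact_mod_cast hx
  have hMMS : (#(box 3 R) : ℝ) * twoPointPlus 3 (criticalBeta 3) x ≤
      ∑ y ∈ box 3 R, twoPointPlus 3 (criticalBeta 3) y :=
    card_box_mul_twoPointPlus_le_sum_box (d := 3) hβ.le hxR
  -- (2) GKS monotonicity in the field, summed over the box
  have hGKS : ∑ y ∈ box 3 R, twoPointPlus 3 (criticalBeta 3) y ≤
      ∑ y ∈ box 3 R, plusExpect 3 (criticalBeta 3) h (spinPair 0 y) :=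
    Finset.sum_le_sum fun y _ => twoPointPlus_le_plusExpect_spinPair hβ.le hh.le y
  -- (1) weak GHS susceptibility bound in the field
  have hGHS : ∑ y ∈ box 3 R, (plusExpect 3 (criticalBeta 3) h (spinPair 0 y) -
      magnetizationInField 3 (criticalBeta 3) h ^ 2) ≤
      magnetizationInField 3 (criticalBeta 3) h / (criticalBeta 3 * h) :=
    PerfectScreeningCoulombImpliesNontrivial.sum_plusTrunc_le_mag_div (d := 3) hβ hh (box 3 R)
  -- (4) `|Λ_R| = (2R+1)³`
  have hcard : (#(box 3 R) : ℝ) = (2 * (R : ℝ) + 1) ^ 3 := by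
    rw [card_box]; push_cast; ring
  have hcrit : criticalTwoPoint 3 x = twoPointPlus 3 (criticalBeta 3) x := rfl
  rw [Finset.sum_sub_distrib, Finset.sum_const, nsmul_eq_mul, hcard] at hGHS
  rw [hcard] at hMMS
  rw [hcrit, mul_sub]
  linarith
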